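import Literature.NumberTheory.Automorphic.UnitaryLatticeTreeEulerRelation   -- ★ root star = `K₀·N₁` (`mem_neighborSet_root_iff_exists_mem_unitaryInt`)
import Literature.NumberTheory.Automorphic.UnitaryLatticeTreeFixedStar       -- ★ fixed-star test `latticeGraphIso_N₁_eq_iff`, ★ `firstColumn_props` (via T1d-C1)
import HarnessLib

/-!
# R90 · S6 «Ch. 14.1–14.5 stable trace formula» — card W8-i″, FILE 3b (RESIDUAL VALUE «REGULAR ANISOTROPIC»): a `k ∈ K₀` with an integral eigenframe of residually
# DISTINCT eigenvalues and residually ANISOTROPIC eigencolumns fixes NO special neighbour of the hyperspecial root — `#{w ∈ star(L₀) | k·w = w} = 0`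
# (`Theorems/R90S6ResidualStarFixedRegular.lean`)

Cell `hodgecm-mathlib`, crux H413 (`stmt-HodgeConjecture-24833`), route of record `HCCMUnconditional`; programme R90-TF, section S6 (base `R90-C14`), seat R90-C14-p05 (g0);
S6 dealer R90-C14-plan (g2) 23:57:28Z «FILE 3 = the per-reduction-type VALUES of the residual count, each WITH its exact hypothesis on k̄, one public theorem per value»
(DAG r5 row E1.3.5.2.4; the depth-0 boundary of the fixed ball of a type-(1) torus element).  Helper lane `--supports stmt-HodgeConjecture-24833 --as helper`; ONE theorem
(no definition, no instance, no notation, no named fact, no `sorry`); imports = ★ `UnitaryLatticeTreeEulerRelation` + ★ `UnitaryLatticeTreeFixedStar` + HarnessLib.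

THE MATHEMATICS [BruhatTits1972, §10; Tits1979, §3.5; Serre1980Trees, II.1.1].  `K` a valued field with an unramified datum `hd : UnramifiedLocalConjDatum σ ϖ`, `U = U(σ, J₀)(K)`,
`B₀` its sesquilinear form, `K₀ = U ∩ GL₃(𝒪)`, `L₀ = 𝒪³`, star `= {κ·N₁ | κ ∈ K₀}`.  Let `k ∈ K₀` have an INTEGRAL EIGENFRAME `P ∈ GL₃(𝒪)` (`P`, `P⁻¹` integral) with
`k·P = P·diag(u)`, RESIDUALLY DISTINCT eigenvalues (`|u_i − u_j| = 1`, `i ≠ j`) and RESIDUALLY ANISOTROPIC eigencolumns `p_i = P e_i` (`|B₀(p_i, p_i)| = 1`) — the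
residual type of a type-(1) torus element at depth `0` (the unit estate's «all norm tests» frame at an inert place).  Then `k` fixes NO vertex of the star.  For if `k` fixed
`κ·N₁`, the fixed-star test (★ `latticeGraphIso_N₁_eq_iff`) gives a unit `c` with `k x ≡ c x (mod 𝔪)` for the first column `x = κe₀`, which is integral, PRIMITIVE and EXACTLY
ISOTROPIC (★ `firstColumn_props`).  In the frame, `y = P⁻¹x` is integral and primitive and `(u_i − c)·y_i ∈ 𝔪` for all `i`; a unit coordinate `y_j` forces `u_j ≡ c`, hence
`|u_i − c| = 1` and `y_i ∈ 𝔪` for `i ≠ j` (ultrametric), i.e. `x = y_j p_j + r` with `r ∈ 𝔪³`; then `B₀(x,x) = σ(y_j) y_j B₀(p_j,p_j) + (terms in 𝔪)` has valuation `1`,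
contradicting `B₀(x, x) = 0`.  So **`{w ∈ star(L₀) | k·w = w} = ∅`**, `ncard = 0` — the value «regular anisotropic ↦ 0» of the residual census `s(x)` of ★ FILE 1
`R90.S6.natCard_fixedBy_special_add_eq_one_add_sum` ∘ ★ FILE 2 `R90.S6.natCard_fixedBy_star_eq_ncard_fixed_neighborSet_root`: a residually regular type-(1) element at a fixed
hyperspecial vertex has NO fixed special neighbour there (the boundary of its fixed ball).  Pure valuation algebra: no residue field, no finiteness.
HONEST LABEL: lattice ∕ valuation bookkeeping over ★ organs; count-neutral until the per-literal censuses + W8-f consume it; proves no printed statement.  HC_CM is proved only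
modulo the 7 printed citations (2 remaining named inputs: hLiu418 = stmt-HodgeConjecture-24832, h413 = stmt-HodgeConjecture-24833) until rung 0 closes.
-/

set_option autoImplicit false
-- the mandated namespace repeats the single-problem summit's segment (`HodgeConjecture.HodgeConjecture`)
set_option linter.dupNamespace false

noncomputable section

open Literature.NumberTheory.Automorphic Literature.NumberTheory.Automorphic.HermitianLattice Literature.NumberTheory.Automorphic.UnitaryGroup
open Literature.NumberTheory.Automorphic.UnitaryLatticeTree
open scoped Matrix MatrixGroups WithZero Valued

namespace Summit.HodgeConjecture.HodgeConjecture.R90.S6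

/-- **W8-i″ FILE 3b — A RESIDUALLY REGULAR `k ∈ K₀` WITH RESIDUALLY ANISOTROPIC EIGENLINES FIXES NO VERTEX OF THE STAR OF THE ROOT: `#{w ∈ star(L₀) | k·w = w} = 0`.**
For an unramified datum `hd`, `k ∈ K₀ = U(σ,J₀) ∩ GL₃(𝒪)`, an eigenframe `P ∈ GL₃(K)` with `P`, `P⁻¹` integral and `k·P = P·diag(u)`, residually distinct eigenvalues
`|u_i − u_j| = 1` (`i ≠ j`) and residually anisotropic eigencolumns `|B₀(P e_i, P e_i)| = 1`: the set of `k`-fixed vertices of the star of `L₀ = 𝒪³` in ★ `latticeGraph σ ϖ J₀`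
is EMPTY (a fixed `κ·N₁` would make the exactly isotropic primitive `κe₀` a residual eigenvector, hence residually on an anisotropic eigenline), so the count of ★ FILE 2 is `0`.
[cite: BruhatTits1972, §10] [cite: Tits1979, §3.5] [cite: Serre1980Trees, II.1.1] -/
theorem ncard_fixed_neighborSet_root_eq_zero_of_residually_regular {K : Type*} [Field K] [Valued K ℤᵐ⁰]
    {σ : K →+* K} {ϖ : K} (hd : UnramifiedLocalConjDatum σ ϖ)
    (k : ↥(unitaryGroupOfForm σ ((StdForm.antidiagonal 3).over K))) (hk : k ∈ unitaryInt σ ((StdForm.antidiagonal 3).over K))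
    (P : GL (Fin 3) K) (hP : ∀ i j, Valued.v ((P : Matrix (Fin 3) (Fin 3) K) i j) ≤ 1) (hP' : ∀ i j, Valued.v (((P⁻¹ : GL (Fin 3) K) : Matrix (Fin 3) (Fin 3) K) i j) ≤ 1)
    (u : Fin 3 → K) (hkP : ((k : GL (Fin 3) K) : Matrix (Fin 3) (Fin 3) K) * (P : Matrix (Fin 3) (Fin 3) K) = (P : Matrix (Fin 3) (Fin 3) K) * Matrix.diagonal u)
    (hreg : ∀ i j, i ≠ j → Valued.v (u i - u j) = 1)
    (hanis : ∀ i, Valued.v (B₀ σ 3 ((P : Matrix (Fin 3) (Fin 3) K).mulVec (Pi.single i 1)) ((P : Matrix (Fin 3) (Fin 3) K).mulVec (Pi.single i 1))) = 1) :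
    {w : {M : Submodule 𝒪[K] (Fin 3 → K) // IsVertex σ ϖ ((StdForm.antidiagonal 3).over K) M} |
        w ∈ (latticeGraph σ ϖ ((StdForm.antidiagonal 3).over K)).neighborSet ⟨stdLattice K 3, 0, isSelfDualLattice_stdLattice_three hd⟩ ∧
          latticeGraphIso σ ϖ ((StdForm.antidiagonal 3).over K) k w = w}.ncard = 0 := by
  classical
  suffices h : {w : {M : Submodule 𝒪[K] (Fin 3 → K) // IsVertex σ ϖ ((StdForm.antidiagonal 3).over K) M} |
      w ∈ (latticeGraph σ ϖ ((StdForm.antidiagonal 3).over K)).neighborSet ⟨stdLattice K 3, 0, isSelfDualLattice_stdLattice_three hd⟩ ∧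
        latticeGraphIso σ ϖ ((StdForm.antidiagonal 3).over K) k w = w} = ∅ by
    rw [h, Set.ncard_empty]
  rw [Set.eq_empty_iff_forall_notMem]
  rintro w ⟨hw, hfix⟩
  obtain ⟨κ, hκ, hw1⟩ := (mem_neighborSet_root_iff_exists_mem_unitaryInt hd w).1 hw
  obtain ⟨c, hc, hcol⟩ := (latticeGraphIso_N₁_eq_iff hd.vσ hd.vϖ hk hκ w hw1).1 hfix
  -- abbreviations
  set kM : Matrix (Fin 3) (Fin 3) K := ((k : GL (Fin 3) K) : Matrix (Fin 3) (Fin 3) K) with hkM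
  set κM : Matrix (Fin 3) (Fin 3) K := ((κ : GL (Fin 3) K) : Matrix (Fin 3) (Fin 3) K) with hκM
  set PM : Matrix (Fin 3) (Fin 3) K := (P : Matrix (Fin 3) (Fin 3) K) with hPM
  set QM : Matrix (Fin 3) (Fin 3) K := ((P⁻¹ : GL (Fin 3) K) : Matrix (Fin 3) (Fin 3) K) with hQM
  have hPQ : PM * QM = 1 := by rw [hPM, hQM, ← Units.val_mul, mul_inv_cancel, Units.val_one]
  have hQP : QM * PM = 1 := by rw [hPM, hQM, ← Units.val_mul, inv_mul_cancel, Units.val_one]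
  -- the first column `x = κe₀`: integral, exactly isotropic, primitive (kept opaque)
  obtain ⟨x, hx⟩ : ∃ x : Fin 3 → K, x = κM.mulVec (Pi.single 0 1) := ⟨_, rfl⟩
  obtain ⟨hxint, hxiso, i₀, hxi₀⟩ := firstColumn_props hκ
  rw [← hκM, ← hx] at hxint hxiso hxi₀
  have hxcol : ∀ i, x i = κM i 0 := fun i => by rw [hx, Matrix.mulVec_single_one]; rfl
  -- `k x ≡ c x (mod 𝔪)`
  have hcol' : ∀ i, Valued.v ((kM.mulVec x - c • x) i) < 1 := by
    intro i
    have e : (kM.mulVec x - c • x) i = (kM * κM) i 0 - c * κM i 0 := by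
      rw [Pi.sub_apply, Pi.smul_apply, smul_eq_mul, hxcol, Matrix.mul_apply]
      simp only [Matrix.mulVec, dotProduct, hxcol]
    rw [e]
    exact hcol i
  -- frame coordinates `y = P⁻¹ x` (opaque): integral, `P y = x`, and `(u_i − c) y_i ∈ 𝔪`
  obtain ⟨y, hy⟩ : ∃ y : Fin 3 → K, y = QM.mulVec x := ⟨_, rfl⟩
  have hPy : PM.mulVec y = x := by rw [hy, Matrix.mulVec_mulVec, hPQ, Matrix.one_mulVec]
  have hyint : ∀ i, Valued.v (y i) ≤ 1 := by rw [hy]; exact mulVec_mem_stdLattice_of_forall_v_le_one hP' hxint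
  have hcong : ∀ i, Valued.v ((u i - c) * y i) < 1 := by
    have h1 : PM.mulVec ((Matrix.diagonal u).mulVec y - c • y) = kM.mulVec x - c • x := by
      rw [Matrix.mulVec_sub, Matrix.mulVec_smul, Matrix.mulVec_mulVec, ← hkP, ← Matrix.mulVec_mulVec, hPy]
    have h2 : (Matrix.diagonal u).mulVec y - c • y = QM.mulVec (kM.mulVec x - c • x) := by
      rw [← h1, Matrix.mulVec_mulVec, hQP, Matrix.one_mulVec]
    intro i
    have h3 : (u i - c) * y i = ((Matrix.diagonal u).mulVec y - c • y) i := by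
      rw [Pi.sub_apply, Pi.smul_apply, smul_eq_mul, Matrix.mulVec_diagonal, sub_mul]
    rw [h3, h2]
    change Valued.v (∑ j, QM i j * (kM.mulVec x - c • x) j) < 1
    refine Valuation.map_sum_lt _ one_ne_zero fun j _ => ?_
    rw [map_mul]
    calc Valued.v (QM i j) * Valued.v ((kM.mulVec x - c • x) j) ≤ 1 * Valued.v ((kM.mulVec x - c • x) j) := mul_le_mul' (hP' i j) le_rfl
      _ < 1 := by rw [one_mul]; exact hcol' j
  -- a unit coordinate `y_j` of the primitive `y`
  obtain ⟨j, hj⟩ : ∃ j, Valued.v (y j) = 1 := by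
    by_contra hne
    push Not at hne
    have hlt : ∀ a, Valued.v (y a) < 1 := fun a => lt_of_le_of_ne (hyint a) (hne a)
    have hxi₀' : Valued.v (x i₀) < 1 := by
      rw [← hPy]
      change Valued.v (∑ a, PM i₀ a * y a) < 1
      refine Valuation.map_sum_lt _ one_ne_zero fun a _ => ?_
      rw [map_mul]
      calc Valued.v (PM i₀ a) * Valued.v (y a) ≤ 1 * Valued.v (y a) := mul_le_mul' (hP i₀ a) le_rfl
        _ < 1 := by rw [one_mul]; exact hlt a
    exact absurd hxi₀ hxi₀'.ne
  -- `u_j ≡ c`, hence `|u_i − c| = 1` and `y_i ∈ 𝔪` for `i ≠ j`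
  have hujc : Valued.v (u j - c) < 1 := by
    have h := hcong j
    rwa [map_mul, hj, mul_one] at h
  have hyi : ∀ i, i ≠ j → Valued.v (y i) < 1 := by
    intro i hij
    have huic : Valued.v (u i - c) = 1 := by
      have e : u i - c = u i - u j + (u j - c) := by ring
      have hlt : Valued.v (u j - c) < Valued.v (u i - u j) := by rw [hreg i j hij]; exact hujc
      rw [e, Valuation.map_add_eq_of_lt_left _ hlt, hreg i j hij]
    have h := hcong i
    rwa [map_mul, huic, one_mul] at h
  -- `x = y_j p + r` with `p = P e_j` integral and `r ∈ 𝔪³` (both opaque)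
  obtain ⟨p, hp⟩ : ∃ p : Fin 3 → K, p = PM.mulVec (Pi.single j 1) := ⟨_, rfl⟩
  obtain ⟨r, hr⟩ : ∃ r : Fin 3 → K, r = PM.mulVec (y - Pi.single j (y j)) := ⟨_, rfl⟩
  have hxdec : x = y j • p + r := by
    rw [← hPy, hp, hr, ← Matrix.mulVec_smul, ← Matrix.mulVec_add]
    congr 1
    funext a
    rw [Pi.add_apply, Pi.smul_apply, Pi.sub_apply, smul_eq_mul]
    by_cases ha : a = j
    · subst ha; rw [Pi.single_eq_same, Pi.single_eq_same]; ring
    · rw [Pi.single_eq_of_ne ha, Pi.single_eq_of_ne ha]; ring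
  have hrlt : ∀ i, Valued.v (r i) < 1 := by
    intro i
    rw [hr]
    change Valued.v (∑ a, PM i a * (y - (Pi.single j (y j) : Fin 3 → K)) a) < 1
    refine Valuation.map_sum_lt _ one_ne_zero fun a _ => ?_
    rw [map_mul]
    have hsmall : Valued.v ((y - (Pi.single j (y j) : Fin 3 → K)) a) < 1 := by
      rw [Pi.sub_apply]
      by_cases ha : a = j
      · subst ha; rw [Pi.single_eq_same, sub_self, map_zero]; exact zero_lt_one
      · rw [Pi.single_eq_of_ne ha, sub_zero]; exact hyi a ha
    calc Valued.v (PM i a) * Valued.v ((y - (Pi.single j (y j) : Fin 3 → K)) a) ≤ 1 * Valued.v ((y - (Pi.single j (y j) : Fin 3 → K)) a) :=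
        mul_le_mul' (hP i a) le_rfl
      _ < 1 := by rw [one_mul]; exact hsmall
  have hpint : ∀ i, Valued.v (p i) ≤ 1 := by rw [hp]; exact mulVec_mem_stdLattice_of_forall_v_le_one hP (single_mem_stdLattice j)
  have hpp : Valued.v (B₀ σ 3 p p) = 1 := by rw [hp]; exact hanis j
  -- `B₀(x, x) = σ(y_j) y_j B₀(p,p) + (σ(y_j) B₀(p, r) + B₀(r, x))`: head of valuation `1`, tail in `𝔪`
  have hBpx : B₀ σ 3 p x = y j * B₀ σ 3 p p + B₀ σ 3 p r := by
    conv_lhs => rw [hxdec]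
    rw [map_add, map_smul, smul_eq_mul]
  have hB : B₀ σ 3 x x = σ (y j) * y j * B₀ σ 3 p p + (σ (y j) * B₀ σ 3 p r + B₀ σ 3 r x) := by
    calc B₀ σ 3 x x = B₀ σ 3 (y j • p + r) x := by rw [← hxdec]
      _ = σ (y j) * B₀ σ 3 p x + B₀ σ 3 r x := by
          rw [map_add, LinearMap.add_apply, LinearMap.map_smulₛₗ, LinearMap.smul_apply, smul_eq_mul]
      _ = σ (y j) * y j * B₀ σ 3 p p + (σ (y j) * B₀ σ 3 p r + B₀ σ 3 r x) := by rw [hBpx]; ring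
  have hhead : Valued.v (σ (y j) * y j * B₀ σ 3 p p) = 1 := by
    rw [map_mul, map_mul, hd.vσ, hj, one_mul, one_mul, hpp]
  have htail : Valued.v (σ (y j) * B₀ σ 3 p r + B₀ σ 3 r x) < 1 := by
    refine Valuation.map_add_lt _ ?_ ?_
    · rw [map_mul, hd.vσ, hj, one_mul, B₀_apply]
      refine Valuation.map_sum_lt _ one_ne_zero fun a _ => ?_
      rw [map_mul, hd.vσ]
      calc Valued.v (p a) * Valued.v (r (Fin.rev a)) ≤ 1 * Valued.v (r (Fin.rev a)) := mul_le_mul' (hpint a) le_rfl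
        _ < 1 := by rw [one_mul]; exact hrlt _
    · rw [B₀_apply]
      refine Valuation.map_sum_lt _ one_ne_zero fun a _ => ?_
      rw [map_mul, hd.vσ]
      calc Valued.v (r a) * Valued.v (x (Fin.rev a)) ≤ Valued.v (r a) * 1 := mul_le_mul' le_rfl (hxint _)
        _ < 1 := by rw [mul_one]; exact hrlt a
  have hv : Valued.v (B₀ σ 3 x x) = 1 := by
    rw [hB, Valuation.map_add_eq_of_lt_left _ (by rw [hhead]; exact htail), hhead]
  rw [hxiso, map_zero] at hv
  exact zero_ne_one hv

end Summit.HodgeConjecture.HodgeConjecture.R90.S6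

end
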